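import Literature.AlgebraicGeometry.Frobenioids.NumberFieldLocalizationCategoriesProofs
import Literature.AlgebraicGeometry.Frobenioids.BCatOrbitsAnyTopology
import HarnessLib

/-!
# Frobenioids II, Example 1.4 (ii) for an ARBITRARY topology on `G`: `E₀` connected, totally
# epimorphic, FSM-description, not of FSM-type; `P₀` totally epimorphic (exact-closure witnesses)

Mochizuki, *The geometry of Frobenioids II*, Kyushu J. Math. **62** (2008) 401–460, §1 Example 1.4
(ii), author's text p. 13 [cite: MochizukiFrdII2008, Ex. 1.4 (ii) p.13].  PROOF-ONLY companion of
`NumberFieldLocalizationCategories.lean` (seat abc-iut-L1-t8) and of the discharge file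
`NumberFieldLocalizationCategoriesProofs.lean`.

The typed facts `NFLocCat.PTotallyEpimorphic G D`, `NFLocCat.EConnected G D`,
`NFLocCat.ETotallyEpimorphic G D`, `NFLocCat.FSMDescription G D`, `NFLocCat.NotFSMType G D` have the
binders `(G : Type u) [Group G] [TopologicalSpace G] (D : Subgroup G)` — an ARBITRARY topology on the
group `G`, no compatibility with the group law.  The landed witnesses (`pTotallyEpimorphic_holds`, …,
`notFSMType_holds`) assume `[IsTopologicalGroup G]` (faithful to print, where `G = Gal(F̃/F)` is
profinite), so they do not reach the universal closures of the constants as typed (abc-iut FACT-LIST rows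
F-0720, F-1167, F-1169, F-1170, F-1171; R7 kernel type-audit DEMOTE:EXTRA-INSTANCE-HYP, abc-iut-w5-d088
gen 2).  This file proves the five closures EXACTLY AS TYPED: the arguments of the discharge file go
through verbatim over the instance-free toolkit `BCatOrbitsAnyTopology.lean` — the only change is that the
test objects `(D/(U∩D), G/U, ι)`, `U = Stab(q) ∩ Stab(q')`, are built as ORBITS OF PAIRS in `Q × Q'`
(continuous for any topology on `G`) instead of coset `G`-sets (whose continuity needs translations of
`G` to be homeomorphisms).  The closures are stated in closed `∀`-form (they are the closures themselves,
not instance-form twins of the landed witnesses).  `EFSMFF` / `PHasTrivialFactorizations` (F-1168,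
F-1175) follow in `NumberFieldLocalizationCategoriesAnyTopologyFSMFF.lean`.  No definitions; nothing here
bears on [IUTchIII].
-/

namespace Literature.AlgebraicGeometry.Frobenioids

namespace NFLocCat

open CategoryTheory CategoryTheory.Limits
open scoped FintypeCatDiscrete

universe u

variable {G : Type u} [Group G] [TopologicalSpace G]

/-! ### Points, test objects (arbitrary topology on `G`) -/

/-- The one-point `G`-set: a connected object of `B(G)` with a single point — arbitrary topology on `G`.
[cite: MochizukiFrdII2008, Ex. 1.4 (ii) p.13] -/
private theorem exists_point_obj' (G : Type u) [Group G] [TopologicalSpace G] :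
    ∃ (T : BCat G) (t₀ : T.obj.V), IsConnectedObj T ∧ ∀ t : T.obj.V, t = t₀ := by
  let TA : Action FintypeCat.{u} G := { V := FintypeCat.of PUnit.{u + 1}, ρ := 1 }
  have hT : Action.IsContinuous TA := BCat.isContinuous_of_smul_eq' TA fun _ _ => rfl
  refine ⟨⟨TA, hT⟩, PUnit.unit, ?_, fun _ => rfl⟩
  exact BCat.isConnectedObj_of_transitive' ⟨TA, hT⟩ PUnit.unit fun _ => ⟨1, rfl⟩

/-- `B(G)⁰` is totally epimorphic, for an arbitrary topology on `G`: every morphism between single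
orbits is surjective. [cite: MochizukiFrdII2008, Prop. 1.5 (iii) p.14] -/
private theorem isTotallyEpimorphic_connectedPart' (G : Type u) [Group G] [TopologicalSpace G] :
    IsTotallyEpimorphic (ConnectedPart (BCat G)) := by
  refine ⟨fun {A B} f => ⟨fun g h e => ?_⟩⟩
  haveI : Epi f.hom := BCat.epi_of_isConnectedObj' f.hom A.property.1 B.property
  have e' : f.hom ≫ g.hom = f.hom ≫ h.hom := congrArg InducedCategory.Hom.hom e
  exact ObjectProperty.hom_ext _ ((cancel_epi f.hom).mp e')

/-- The structure arrow `ι : P → Q|_D` of an object of `E₀` is injective on points (arbitrary topology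
on `G`). [cite: MochizukiFrdII2008, Ex. 1.4 (i) p.12] -/
private theorem hom_injective' (D : Subgroup G) (T : ECat G D) :
    Function.Injective T.obj.hom.hom.hom := by
  haveI : Mono T.obj.hom := T.property
  exact BCat.injective_of_mono' T.obj.hom

/-- Two morphisms of `E₀` with the same `P`-component are equal (arbitrary topology on `G`).
[cite: MochizukiFrdII2008, Ex. 1.4 (ii) p.13] -/
private theorem hom_eq_of_left_eq' (D : Subgroup G) {T T' : ECat G D} {f f' : T ⟶ T'}
    (h : f.hom.left = f'.hom.left) : f = f' := by
  obtain ⟨p⟩ := nonempty_left D T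
  apply ObjectProperty.hom_ext
  apply Comma.hom_ext _ _ h
  apply ObjectProperty.hom_ext
  apply BCat.hom_eq_of_apply_eq' T.obj.right.property (T.obj.hom.hom.hom p)
  have w₁ := w_apply D f p
  have w₂ := w_apply D f' p
  rw [h] at w₁
  exact w₁.symm.trans w₂

/-- Points of `P` fixed under `ι` by `d ∈ D` are fixed by `d` (arbitrary topology on `G`).
[cite: MochizukiFrdII2008, Ex. 1.4 (i) p.12] -/
private theorem smul_eq_of_mem_stabilizer' (D : Subgroup G) (T : ECat G D) (z : T.obj.left.obj.obj.V)
    (d : D) (q : T.obj.right.obj.obj.V) (hq : T.obj.hom.hom.hom z = q)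
    (hd : (d : G) ∈ MulAction.stabilizer G q) : d • z = z := by
  apply hom_injective' D T
  have e₂ := MulAction.mem_stabilizer_iff.mp hd
  rw [← hq] at e₂
  exact (BCat.hom_smul T.obj.hom d z).trans e₂

/-- The test objects of Example 1.4 (ii) for an ARBITRARY topology on `G`: for points `q ∈ Q`, `q' ∈ Q'`
of objects of `B(G)` and `U := Stab(q) ∩ Stab(q')`, an object `T₄ = (P₄, Q₄, ι₄)` of `E₀` with base
points `p₄ ↦ q₄`, both components single orbits with `Stab(q₄) = U`, `Stab_D(p₄) = U ∩ D`, mapping to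
every `(P'', Q'', ι'')` through prescribed `U`-fixed points — built from the ORBITS OF THE PAIR `(q, q')`
in `Q × Q'` (under `G`) and in `Q|_D × Q'|_D` (under `D`) instead of the coset objects `G/U`,
`D/(U ∩ D)`. [cite: MochizukiFrdII2008, Ex. 1.4 (ii) p.13] -/
private theorem exists_testObj' (D : Subgroup G) (Q Q' : BCat G) (q : Q.obj.V) (q' : Q'.obj.V) :
    ∃ (T₄ : ECat G D) (p₄ : T₄.obj.left.obj.obj.V) (q₄ : T₄.obj.right.obj.obj.V),
      T₄.obj.hom.hom.hom p₄ = q₄ ∧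
      (∀ p : T₄.obj.left.obj.obj.V, ∃ d : D, d • p₄ = p) ∧
      (∀ z : T₄.obj.right.obj.obj.V, ∃ g : G, g • q₄ = z) ∧
      (∀ (Y : BCat G) (y : Y.obj.V),
          MulAction.stabilizer G q ⊓ MulAction.stabilizer G q' ≤ MulAction.stabilizer G y →
          ∃ b : T₄.obj.right.obj ⟶ Y, b.hom.hom q₄ = y) ∧
      (∀ (X : BCat D) (x : X.obj.V),
          (∀ d : D, (d : G) ∈ MulAction.stabilizer G q ⊓ MulAction.stabilizer G q' → d • x = x) →
          ∃ a : T₄.obj.left.obj ⟶ X, a.hom.hom p₄ = x) := by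
  obtain ⟨Q₄, q₄, hq₄, htrQ, hmapQ⟩ := BCat.exists_pairOrbit_obj Q Q' q q'
  obtain ⟨P₄, p₄, hp₄, htrP, hmapP⟩ :=
    BCat.exists_pairOrbit_obj (G := D) ((res G D).obj Q) ((res G D).obj Q') q q'
  -- the stabiliser in `D` of the base point `p₄` (restricted actions) is cut out by `U`
  have hstabD : ∀ d : D, d ∈ MulAction.stabilizer (↥D) p₄ ↔
      (d : G) ∈ MulAction.stabilizer G q ⊓ MulAction.stabilizer G q' := fun d => by
    rw [hp₄, Subgroup.mem_inf, Subgroup.mem_inf, MulAction.mem_stabilizer_iff,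
      MulAction.mem_stabilizer_iff, MulAction.mem_stabilizer_iff, MulAction.mem_stabilizer_iff]
    exact Iff.rfl
  -- `ι₄ : P₄ → Q₄|_D`, `p₄ ↦ q₄`
  obtain ⟨ι₄, hι₄⟩ := hmapP ((res G D).obj Q₄) q₄ fun d hd => by
    rw [← hp₄] at hd
    have hd' := (hstabD d).mp hd
    rw [← hq₄] at hd'
    exact MulAction.mem_stabilizer_iff.mpr (MulAction.mem_stabilizer_iff.mp hd')
  have hι₄m : Mono ι₄ := BCat.mono_of_injective ι₄ (BCat.injective_of_stabilizer_le ι₄ p₄ htrP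
    fun d hd => by
      apply (hstabD d).mpr
      rw [← hq₄]
      rw [hι₄] at hd
      exact MulAction.mem_stabilizer_iff.mpr (MulAction.mem_stabilizer_iff.mp hd))
  let T₄ : ECat G D :=
    ⟨⟨⟨P₄, BCat.isConnectedObj_of_transitive' P₄ p₄ htrP⟩,
      ⟨Q₄, BCat.isConnectedObj_of_transitive' Q₄ q₄ htrQ⟩, ι₄⟩, hι₄m⟩
  refine ⟨T₄, p₄, q₄, hι₄, htrP, htrQ, fun Y y hy => hmapQ Y y hy, ?_⟩
  intro X x hx
  refine hmapP X x fun d hd => MulAction.mem_stabilizer_iff.mpr (hx d ?_)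
  rw [← hp₄] at hd
  exact (hstabD d).mp hd

/-! ### The five exact-closure witnesses -/

/-- FACT-LIST F-0720 — FrdII Ex. 1.4 (ii) / Prop. 1.5 (iii): "`P₀` [= `B(D_v)⁰`] is totally
epimorphic": the UNIVERSAL CLOSURE of `NFLocCat.PTotallyEpimorphic` exactly as typed (arbitrary topology
on `G`), PROVED. [cite: MochizukiFrdII2008, Prop. 1.5 (iii) p.14] -/
theorem PTotallyEpimorphic_closure :
    ∀ (G : Type u) [Group G] [TopologicalSpace G] (D : Subgroup G), PTotallyEpimorphic G D :=
  fun _ _ _ D => isTotallyEpimorphic_connectedPart' D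

/-- FACT-LIST F-1169 — FrdII Ex. 1.4 (ii): "`E₀` is … totally epimorphic": the UNIVERSAL CLOSURE of
`NFLocCat.ETotallyEpimorphic` exactly as typed (arbitrary topology on `G`), PROVED (both components of a
morphism of `E₀` are maps between single orbits, hence epimorphisms). [cite: MochizukiFrdII2008, Ex. 1.4 (ii) p.13] -/
theorem ETotallyEpimorphic_closure :
    ∀ (G : Type u) [Group G] [TopologicalSpace G] (D : Subgroup G), ETotallyEpimorphic G D := by
  intro G _ _ D
  refine ⟨fun {T T'} f => ⟨fun {T''} g h e => ?_⟩⟩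
  haveI : Epi f.hom.left := (isTotallyEpimorphic_connectedPart' (D : Type u)).epi f.hom.left
  have e' : f.hom.left ≫ g.hom.left = f.hom.left ≫ h.hom.left :=
    congrArg (fun k => CommaMorphism.left (InducedCategory.Hom.hom k)) e
  exact hom_eq_of_left_eq' D ((cancel_epi f.hom.left).mp e')

/-- FACT-LIST F-1167 — FrdII Ex. 1.4 (ii): "the category `E₀` is connected": the UNIVERSAL CLOSURE of
`NFLocCat.EConnected` exactly as typed (arbitrary topology on `G`), PROVED: every object maps to
`(pt, pt, id)`. [cite: MochizukiFrdII2008, Ex. 1.4 (ii) p.13] -/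
theorem EConnected_closure :
    ∀ (G : Type u) [Group G] [TopologicalSpace G] (D : Subgroup G), EConnected G D := by
  intro G _ _ D
  obtain ⟨P₁, p₁, hP₁, hp₁⟩ := exists_point_obj' (D : Type u)
  obtain ⟨Q₁, q₁, hQ₁, hq₁⟩ := exists_point_obj' G
  let ι₁ : P₁ ⟶ (res G D).obj Q₁ := ObjectProperty.homMk
    { hom := FintypeCat.homMk fun _ => (q₁ : ((res G D).obj Q₁).obj.V)
      comm := fun _ => FintypeCat.hom_ext _ _ fun _ => (hq₁ _).symm }
  have hι₁ : Mono ι₁ := BCat.mono_of_injective ι₁ fun a b _ => (hp₁ a).trans (hp₁ b).symm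
  let T₁ : ECat G D := ⟨⟨⟨P₁, hP₁⟩, ⟨Q₁, hQ₁⟩, ι₁⟩, hι₁⟩
  have to₁ : ∀ T : ECat G D, Nonempty (T ⟶ T₁) := fun T =>
    ⟨ObjectProperty.homMk
      { left := ObjectProperty.homMk (ObjectProperty.homMk
          { hom := FintypeCat.homMk fun _ => p₁
            comm := fun _ => FintypeCat.hom_ext _ _ fun _ => (hp₁ _).symm })
        right := ObjectProperty.homMk (ObjectProperty.homMk
          { hom := FintypeCat.homMk fun _ => q₁
            comm := fun _ => FintypeCat.hom_ext _ _ fun _ => (hq₁ _).symm })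
        w := BCat.hom_ext_apply fun _ => (hq₁ _).trans (hq₁ _).symm }⟩
  haveI : Nonempty (ECat G D) := ⟨T₁⟩
  exact zigzag_isConnected fun T T' =>
    (Zigzag.of_hom (to₁ T).some).trans (Zigzag.of_inv (to₁ T').some)

/-- FACT-LIST F-1170 — FrdII Ex. 1.4 (ii): the FSM-morphisms of `E₀` that are not isomorphisms are
exactly the morphisms whose `P`-component is an isomorphism [and which are not isomorphisms]: the
UNIVERSAL CLOSURE of `NFLocCat.FSMDescription` exactly as typed (arbitrary topology on `G`), PROVED —
the argument of `fsmDescription_holds`, with pair-orbit test objects. [cite: MochizukiFrdII2008, Ex. 1.4 (ii) p.13] -/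
theorem FSMDescription_closure :
    ∀ (G : Type u) [Group G] [TopologicalSpace G] (D : Subgroup G), FSMDescription G D := by
  intro G _ _ D T T' f
  obtain ⟨p⟩ := nonempty_left D T
  -- morphisms `T₄ ⟶ T''` from components agreeing at the base point
  have mk : ∀ {T₄ T'' : ECat G D} (p₄ : T₄.obj.left.obj.obj.V) (q₄ : T₄.obj.right.obj.obj.V),
      T₄.obj.hom.hom.hom p₄ = q₄ → (∀ p : T₄.obj.left.obj.obj.V, ∃ d : D, d • p₄ = p) →
      ∀ (a : T₄.obj.left.obj ⟶ T''.obj.left.obj) (b : T₄.obj.right.obj ⟶ T''.obj.right.obj),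
        T''.obj.hom.hom.hom (a.hom.hom p₄) = b.hom.hom q₄ →
        ∃ u : T₄ ⟶ T'', u.hom.left = ObjectProperty.homMk a ∧ u.hom.right = ObjectProperty.homMk b :=
    fun {T₄ T''} p₄ q₄ hq htrP a b hab =>
      ⟨ObjectProperty.homMk
        { left := ObjectProperty.homMk a
          right := ObjectProperty.homMk b
          w := BCat.hom_eq_of_apply_eq_of_transitive p₄ htrP (by
            change T''.obj.hom.hom.hom (a.hom.hom p₄) = b.hom.hom (T₄.obj.hom.hom.hom p₄)
            rw [hq]
            exact hab) }, rfl, rfl⟩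
  constructor
  · rintro ⟨⟨_, hmono⟩, hni⟩
    refine ⟨?_, hni⟩
    have hsurj : Function.Surjective f.hom.left.hom.hom.hom :=
      BCat.surjective_of_isConnectedObj' f.hom.left.hom p T'.obj.left.property
    have hinj : Function.Injective f.hom.left.hom.hom.hom := by
      intro x y hxy
      by_contra hne
      obtain ⟨T₄, p₄, q₄, hq₄, htrP, htrQ, hmapQ, hmapP⟩ := exists_testObj' D T.obj.right.obj
        T.obj.right.obj (T.obj.hom.hom.hom x) (T.obj.hom.hom.hom y)
      obtain ⟨a₁, ha₁⟩ := hmapP T.obj.left.obj x fun d hd =>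
        smul_eq_of_mem_stabilizer' D T x d _ rfl (Subgroup.mem_inf.mp hd).1
      obtain ⟨a₂, ha₂⟩ := hmapP T.obj.left.obj y fun d hd =>
        smul_eq_of_mem_stabilizer' D T y d _ rfl (Subgroup.mem_inf.mp hd).2
      obtain ⟨b₁, hb₁⟩ := hmapQ T.obj.right.obj (T.obj.hom.hom.hom x) inf_le_left
      obtain ⟨b₂, hb₂⟩ := hmapQ T.obj.right.obj (T.obj.hom.hom.hom y) inf_le_right
      obtain ⟨u₁, hu₁l, hu₁r⟩ := mk p₄ q₄ hq₄ htrP a₁ b₁ (by rw [ha₁, hb₁])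
      obtain ⟨u₂, hu₂l, hu₂r⟩ := mk p₄ q₄ hq₄ htrP a₂ b₂ (by rw [ha₂, hb₂])
      have e : u₁ ≫ f = u₂ ≫ f := by
        apply ObjectProperty.hom_ext
        apply Comma.hom_ext
        · change u₁.hom.left ≫ f.hom.left = u₂.hom.left ≫ f.hom.left
          rw [hu₁l, hu₂l]
          apply ObjectProperty.hom_ext
          apply BCat.hom_eq_of_apply_eq_of_transitive p₄ htrP
          change f.hom.left.hom.hom.hom (a₁.hom.hom p₄) = f.hom.left.hom.hom.hom (a₂.hom.hom p₄)
          rw [ha₁, ha₂, hxy]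
        · change u₁.hom.right ≫ f.hom.right = u₂.hom.right ≫ f.hom.right
          rw [hu₁r, hu₂r]
          apply ObjectProperty.hom_ext
          apply BCat.hom_eq_of_apply_eq_of_transitive q₄ htrQ
          change f.hom.right.hom.hom.hom (b₁.hom.hom q₄) = f.hom.right.hom.hom.hom (b₂.hom.hom q₄)
          rw [hb₁, hb₂, ← w_apply D f x, ← w_apply D f y, hxy]
      haveI := hmono
      have e' : u₁ = u₂ := (cancel_mono f).mp e
      have : a₁.hom.hom p₄ = a₂.hom.hom p₄ := by
        have h := congrArg (fun k : T₄ ⟶ T => k.hom.left) e'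
        rw [hu₁l, hu₂l] at h
        exact congrArg (fun k : T₄.obj.left ⟶ T.obj.left => k.hom.hom.hom p₄) h
      rw [ha₁, ha₂] at this
      exact hne this
    haveI : IsIso f.hom.left.hom := BCat.isIso_of_bijective f.hom.left.hom ⟨hinj, hsurj⟩
    exact (ObjectProperty.isIso_hom_iff f.hom.left).mp inferInstance
  · rintro ⟨hiso, hni⟩
    refine ⟨⟨?_, ⟨fun {T''} u₁ u₂ e => ?_⟩⟩, hni⟩
    · -- fiberwise surjectivity
      intro T₃ γ
      obtain ⟨p₃⟩ := nonempty_left D T₃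
      obtain ⟨x, hx⟩ := BCat.surjective_of_isConnectedObj' f.hom.left.hom p T'.obj.left.property
        (γ.hom.left.hom.hom.hom p₃)
      obtain ⟨T₄, p₄, q₄, hq₄, htrP, htrQ, hmapQ, hmapP⟩ := exists_testObj' D T.obj.right.obj
        T₃.obj.right.obj (T.obj.hom.hom.hom x) (T₃.obj.hom.hom.hom p₃)
      obtain ⟨a₁, ha₁⟩ := hmapP T.obj.left.obj x fun d hd =>
        smul_eq_of_mem_stabilizer' D T x d _ rfl (Subgroup.mem_inf.mp hd).1
      obtain ⟨a₂, ha₂⟩ := hmapP T₃.obj.left.obj p₃ fun d hd =>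
        smul_eq_of_mem_stabilizer' D T₃ p₃ d _ rfl (Subgroup.mem_inf.mp hd).2
      obtain ⟨b₁, hb₁⟩ := hmapQ T.obj.right.obj (T.obj.hom.hom.hom x) inf_le_left
      obtain ⟨b₂, hb₂⟩ := hmapQ T₃.obj.right.obj (T₃.obj.hom.hom.hom p₃) inf_le_right
      obtain ⟨δ, hδl, hδr⟩ := mk p₄ q₄ hq₄ htrP a₁ b₁ (by rw [ha₁, hb₁])
      obtain ⟨ε, hεl, hεr⟩ := mk p₄ q₄ hq₄ htrP a₂ b₂ (by rw [ha₂, hb₂])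
      refine ⟨T₄, δ, ε, ?_⟩
      apply ObjectProperty.hom_ext
      apply Comma.hom_ext
      · change δ.hom.left ≫ f.hom.left = ε.hom.left ≫ γ.hom.left
        rw [hδl, hεl]
        apply ObjectProperty.hom_ext
        apply BCat.hom_eq_of_apply_eq_of_transitive p₄ htrP
        change f.hom.left.hom.hom.hom (a₁.hom.hom p₄) = γ.hom.left.hom.hom.hom (a₂.hom.hom p₄)
        rw [ha₁, ha₂, hx]
      · change δ.hom.right ≫ f.hom.right = ε.hom.right ≫ γ.hom.right
        rw [hδr, hεr]
        apply ObjectProperty.hom_ext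
        apply BCat.hom_eq_of_apply_eq_of_transitive q₄ htrQ
        change f.hom.right.hom.hom.hom (b₁.hom.hom q₄) = γ.hom.right.hom.hom.hom (b₂.hom.hom q₄)
        rw [hb₁, hb₂, ← w_apply D f x, ← w_apply D γ p₃, hx]
    · -- monomorphism
      have el : u₁.hom.left ≫ f.hom.left = u₂.hom.left ≫ f.hom.left :=
        congrArg (fun k => CommaMorphism.left (InducedCategory.Hom.hom k)) e
      haveI : IsIso f.hom.left := hiso
      exact hom_eq_of_left_eq' D ((cancel_mono f.hom.left).mp el)

/-- FACT-LIST F-1171 — FrdII Ex. 1.4 (ii): "Thus, the category `E₀` is not [in general] of FSM-type",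
typed form: the UNIVERSAL CLOSURE of `NFLocCat.NotFSMType` exactly as typed (arbitrary topology on `G`),
PROVED — a morphism with invertible `P`-component which is not an isomorphism is FSM, not iso.
[cite: MochizukiFrdII2008, Ex. 1.4 (ii) p.13] -/
theorem NotFSMType_closure :
    ∀ (G : Type u) [Group G] [TopologicalSpace G] (D : Subgroup G), NotFSMType G D := by
  rintro G _ _ D ⟨T, T', f, hiso, hni⟩ hC
  exact hni (hC.isIso_of_isFSM f ((FSMDescription_closure G D f).mpr ⟨hiso, hni⟩).1)

end NFLocCat

end Literature.AlgebraicGeometry.Frobenioids
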